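import Mathlib
import HarnessLib
import Summits.Ventures.LatticeQCDFlow.TrivializingMaps.FiniteRangeDecorrelation

/-!
HONEST FRAMING: exact (Metropolis-corrected) sampling algorithms for lattice gauge theory; figures of
merit are autocorrelation/cost numbers at stated couplings and volumes; no continuum-physics claim.

# QuasiLocalDecorrelation — PROPOSITION R′ of THEORY-1.md §13.5 / §20.2: an EXACT trivializing map is
# never more local than its target is correlated

Proposed tree path: `Summits/Ventures/LatticeQCDFlow/TrivializingMaps/QuasiLocalDecorrelation.lean`
(OURS — venture work, never `Literature/`). Cell `lqcd-flow` (pub-lqcd), unit `pub-lqcd-theory1-g11`,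
2026-08-21.  Imports: Mathlib, HarnessLib + `FiniteRangeDecorrelation` (PROPOSITION R).  Everything
PROVED, 0 sorries.

PROPOSITION R (`FiniteRangeDecorrelation`) says that a FINITE-RANGE map of i.i.d. link variables produces
exactly uncorrelated observables beyond twice its range, so no exact trivializing map of a correlated
target has finite range.  Lüscher's exact map (the time-1 flow of the exact generator) is indeed not of
finite range but QUASI-LOCAL: inside THEOREM A's disc the generator is exponentially local (THEORY-1 §12
corollary), so the map is approximated, uniformly and through every local observable, by the maps `Ψ_r`
driven by the generator truncated to plaquette-distance `r`, with error `δ(r) = O(e^{-m r})`.  This file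
turns that into a DECAY STATEMENT for the target:

* `abs_cov_sub_cov_le` — covariance is Lipschitz under uniform perturbation of the two observables on a
  probability space: `|Cov(f,g) - Cov(f',g')| ≤ 2 (δ₁ b + a δ₂)` for `|f|,|f'| ≤ a`, `|g|,|g'| ≤ b`,
  `|f - f'| ≤ δ₁`, `|g - g'| ≤ δ₂` (folklore);
* **PROPOSITION R′** `abs_cov_pushforward_le_of_approx` — for ANY measurable map `Φ` with a measurable
  range-`r` approximant `Ψ` seen through the observables (`|A∘Φ - A∘Ψ| ≤ δ_A`, `|B∘Φ - B∘Ψ| ≤ δ_B`),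
  observables `|A| ≤ a`, `|B| ≤ b` supported more than `2 r` apart satisfy
  `|Cov_{Φ_*⊗μ₀}(A, B)| ≤ 2 (δ_A b + a δ_B)`.

READING (THEORY-1 §20.2): the connected correlators of an exactly trivialized law decay in the separation
at least as fast as the map's locality tail `δ(sep/2)`; equivalently an exact trivializing map of a law
with correlation length `ξ` has locality rate `m ≤ 2/ξ`.  For Lüscher's construction this is consistent
with — and is the converse bookkeeping of — THEOREM A: the disc where the generator is provably
exponentially local is a strong-coupling disc, where `ξ` is small.
-/

namespace Summit.Ventures.LatticeQCDFlow.TrivializingMaps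

open MeasureTheory ProbabilityTheory Set

section QuasiLocal

variable {Ω : Type*} [MeasurableSpace Ω]

/-- **Covariance is Lipschitz under uniform perturbation of the observables.**  On a probability space,
for measurable `f, f'` bounded by `a`, `g, g'` bounded by `b`, with `|f - f'| ≤ δ₁` and `|g - g'| ≤ δ₂`
pointwise: `|Cov(f, g) - Cov(f', g')| ≤ 2 (δ₁ b + a δ₂)`. [folklore] -/
theorem abs_cov_sub_cov_le (μ : Measure Ω) [IsProbabilityMeasure μ] {f f' g g' : Ω → ℝ}
    (hfm : Measurable f) (hf'm : Measurable f') (hgm : Measurable g) (hg'm : Measurable g')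
    {a b δ₁ δ₂ : ℝ} (hfa : ∀ x, |f x| ≤ a) (hf'a : ∀ x, |f' x| ≤ a) (hgb : ∀ x, |g x| ≤ b)
    (hg'b : ∀ x, |g' x| ≤ b) (hδ₁ : ∀ x, |f x - f' x| ≤ δ₁) (hδ₂ : ∀ x, |g x - g' x| ≤ δ₂) :
    |(∫ x, f x * g x ∂μ - (∫ x, f x ∂μ) * ∫ x, g x ∂μ) -
        (∫ x, f' x * g' x ∂μ - (∫ x, f' x ∂μ) * ∫ x, g' x ∂μ)| ≤ 2 * (δ₁ * b + a * δ₂) := by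
  obtain ⟨x₀⟩ : Nonempty Ω := nonempty_of_isProbabilityMeasure μ
  have ha : 0 ≤ a := (abs_nonneg _).trans (hfa x₀)
  have hd1 : 0 ≤ δ₁ := (abs_nonneg _).trans (hδ₁ x₀)
  -- bounded measurable functions on a probability space are integrable, and `|∫ h| ≤ c` for `|h| ≤ c`
  have hint : ∀ {h : Ω → ℝ}, Measurable h → ∀ {c : ℝ}, (∀ x, |h x| ≤ c) → Integrable h μ :=
    fun hm c hc => Integrable.mono' (integrable_const c) hm.aestronglyMeasurable
      (ae_of_all _ fun x => (Real.norm_eq_abs _).le.trans (hc x))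
  have hmean : ∀ {h : Ω → ℝ} {c : ℝ}, (∀ x, |h x| ≤ c) → |∫ x, h x ∂μ| ≤ c := by
    intro h c hc
    have := norm_integral_le_of_norm_le_const (μ := μ) (f := h) (C := c)
      (Filter.Eventually.of_forall fun x => by simpa [Real.norm_eq_abs] using hc x)
    simpa [Real.norm_eq_abs] using this
  -- second moments
  have p1 : ∀ x, |(f x - f' x) * g x + f' x * (g x - g' x)| ≤ δ₁ * b + a * δ₂ := by
    intro x
    have t1 : |(f x - f' x) * g x| ≤ δ₁ * b := by
      rw [abs_mul]; exact mul_le_mul (hδ₁ x) (hgb x) (abs_nonneg _) hd1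
    have t2 : |f' x * (g x - g' x)| ≤ a * δ₂ := by
      rw [abs_mul]; exact mul_le_mul (hf'a x) (hδ₂ x) (abs_nonneg _) ha
    exact (abs_add_le _ _).trans (add_le_add t1 t2)
  have e1 : ∫ x, f x * g x ∂μ - ∫ x, f' x * g' x ∂μ =
      ∫ x, ((f x - f' x) * g x + f' x * (g x - g' x)) ∂μ := by
    have i1 : Integrable (fun x => f x * g x) μ :=
      hint (h := fun x => f x * g x) (hfm.mul hgm) (c := a * b) fun x => by
        simpa only [abs_mul] using mul_le_mul (hfa x) (hgb x) (abs_nonneg _) ha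
    have i2 : Integrable (fun x => f' x * g' x) μ :=
      hint (h := fun x => f' x * g' x) (hf'm.mul hg'm) (c := a * b) fun x => by
        simpa only [abs_mul] using mul_le_mul (hf'a x) (hg'b x) (abs_nonneg _) ha
    rw [← integral_sub i1 i2]
    congr 1
    ext x
    ring
  have m1 : |∫ x, f x * g x ∂μ - ∫ x, f' x * g' x ∂μ| ≤ δ₁ * b + a * δ₂ := by
    rw [e1]; exact hmean p1
  -- first moments
  have e2 : ∫ x, f x ∂μ - ∫ x, f' x ∂μ = ∫ x, (f x - f' x) ∂μ :=
    (integral_sub (hint hfm hfa) (hint hf'm hf'a)).symm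
  have e3 : ∫ x, g x ∂μ - ∫ x, g' x ∂μ = ∫ x, (g x - g' x) ∂μ :=
    (integral_sub (hint hgm hgb) (hint hg'm hg'b)).symm
  have q1 : |∫ x, f x ∂μ - ∫ x, f' x ∂μ| ≤ δ₁ := by rw [e2]; exact hmean hδ₁
  have q2 : |∫ x, g x ∂μ - ∫ x, g' x ∂μ| ≤ δ₂ := by rw [e3]; exact hmean hδ₂
  have q3 : |∫ x, g x ∂μ| ≤ b := hmean hgb
  have q4 : |∫ x, f' x ∂μ| ≤ a := hmean hf'a
  have m2 : |(∫ x, f x ∂μ) * (∫ x, g x ∂μ) - (∫ x, f' x ∂μ) * ∫ x, g' x ∂μ| ≤ δ₁ * b + a * δ₂ := by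
    have e : (∫ x, f x ∂μ) * (∫ x, g x ∂μ) - (∫ x, f' x ∂μ) * ∫ x, g' x ∂μ =
        (∫ x, f x ∂μ - ∫ x, f' x ∂μ) * (∫ x, g x ∂μ) +
          (∫ x, f' x ∂μ) * (∫ x, g x ∂μ - ∫ x, g' x ∂μ) := by ring
    rw [e]
    have t1 : |(∫ x, f x ∂μ - ∫ x, f' x ∂μ) * ∫ x, g x ∂μ| ≤ δ₁ * b := by
      rw [abs_mul]; exact mul_le_mul q1 q3 (abs_nonneg _) hd1
    have t2 : |(∫ x, f' x ∂μ) * (∫ x, g x ∂μ - ∫ x, g' x ∂μ)| ≤ a * δ₂ := by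
      rw [abs_mul]; exact mul_le_mul q4 q2 (abs_nonneg _) ha
    exact (abs_add_le _ _).trans (add_le_add t1 t2)
  have e4 : (∫ x, f x * g x ∂μ - (∫ x, f x ∂μ) * ∫ x, g x ∂μ) -
      (∫ x, f' x * g' x ∂μ - (∫ x, f' x ∂μ) * ∫ x, g' x ∂μ) =
      (∫ x, f x * g x ∂μ - ∫ x, f' x * g' x ∂μ) -
        ((∫ x, f x ∂μ) * (∫ x, g x ∂μ) - (∫ x, f' x ∂μ) * ∫ x, g' x ∂μ) := by ring
  rw [e4]
  exact (abs_sub _ _).trans (by linarith)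

variable {ι : Type*} [Fintype ι] {α : Type*} [MeasurableSpace α]
variable (μ₀ : Measure α) [IsProbabilityMeasure μ₀]

/-- **PROPOSITION R′ (quasi-local maps).**  Let `Φ` be ANY measurable field map (e.g. an exact
trivializing map, which by PROPOSITION R is never of finite range) and `Ψ` a measurable RANGE-`r`
APPROXIMANT of it, seen through the two observables: `|A ∘ Φ - A ∘ Ψ| ≤ δ_A`, `|B ∘ Φ - B ∘ Ψ| ≤ δ_B`
(for Lüscher's map, `Ψ` = the map driven by the generator truncated to plaquette-distance `r`, and
`δ = O(e^{-m r})` with `m` the locality rate of the generator — THEORY-1 §12 corollary, §13.5).  Then for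
measurable `|A| ≤ a`, `|B| ≤ b` supported more than `2 r` apart,
`|Cov_{Φ_* ⊗μ₀}(A, B)| ≤ 2 (δ_A b + a δ_B)`.  READING: the connected correlators of an exactly
trivialized law decay in the separation at least as fast as the map's locality tail `δ(sep / 2)`; an
exact trivializing map of a law with correlation length `ξ` has locality rate `m ≤ 2 / ξ` — the map is
never more local than the target is correlated. -/
theorem abs_cov_pushforward_le_of_approx (d : ι → ι → ℕ) (hsymm : ∀ a b, d a b = d b a)
    (htri : ∀ a b c, d a c ≤ d a b + d b c) {Φ Ψ : (ι → α) → (ι → α)} (hΦm : Measurable Φ)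
    (hΨm : Measurable Ψ) {N : ι → Set ι} (hΨ : ∀ i, DependsOn (fun W => Ψ W i) (N i)) {r : ℕ}
    (hN : ∀ i, ∀ j ∈ N i, d i j ≤ r) {A B : (ι → α) → ℝ} (hAm : Measurable A) (hBm : Measurable B)
    {a b : ℝ} (hAa : ∀ x, |A x| ≤ a) (hBb : ∀ x, |B x| ≤ b) {S T : Set ι} (hA : DependsOn A S)
    (hB : DependsOn B T) (hsep : ∀ i ∈ S, ∀ j ∈ T, 2 * r < d i j) {δA δB : ℝ}
    (hδA : ∀ V, |A (Φ V) - A (Ψ V)| ≤ δA) (hδB : ∀ V, |B (Φ V) - B (Ψ V)| ≤ δB) :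
    |∫ U, A U * B U ∂(Measure.pi fun _ : ι => μ₀).map Φ -
        (∫ U, A U ∂(Measure.pi fun _ : ι => μ₀).map Φ) *
          ∫ U, B U ∂(Measure.pi fun _ : ι => μ₀).map Φ| ≤ 2 * (δA * b + a * δB) := by
  have hABm : AEStronglyMeasurable (fun U => A U * B U) ((Measure.pi fun _ : ι => μ₀).map Φ) :=
    (hAm.mul hBm).aestronglyMeasurable
  rw [integral_map hΦm.aemeasurable hABm, integral_map hΦm.aemeasurable hAm.aestronglyMeasurable,
    integral_map hΦm.aemeasurable hBm.aestronglyMeasurable]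
  -- the range-`r` approximant decorrelates exactly (PROPOSITION R in the `μ` picture)
  have h0 : ∫ V, A (Ψ V) * B (Ψ V) ∂Measure.pi (fun _ : ι => μ₀) -
      (∫ V, A (Ψ V) ∂Measure.pi (fun _ : ι => μ₀)) * ∫ V, B (Ψ V) ∂Measure.pi (fun _ : ι => μ₀) = 0 :=
    sub_eq_zero.2 (integral_mul_eq_of_dependsOn_sets μ₀
      (disjoint_readClosure_of_separated d hsymm htri hN hsep) (hAm.comp hΨm) (hBm.comp hΨm)
      (DependsOn.comp_fieldMap hΨ hA) (DependsOn.comp_fieldMap hΨ hB))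
  have := abs_cov_sub_cov_le (Measure.pi fun _ : ι => μ₀) (f := fun V => A (Φ V))
    (f' := fun V => A (Ψ V)) (g := fun V => B (Φ V)) (g' := fun V => B (Ψ V)) (hAm.comp hΦm)
    (hAm.comp hΨm) (hBm.comp hΦm) (hBm.comp hΨm) (fun V => hAa _) (fun V => hAa _) (fun V => hBb _)
    (fun V => hBb _) hδA hδB
  rwa [h0, sub_zero] at this

end QuasiLocal

end Summit.Ventures.LatticeQCDFlow.TrivializingMaps
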